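import Summits.AtomisticToContinuum.Crystallization.Theorems.FrustratedLawDichotomyTwoShellRigidityGaugedLadderD

/-!
# FrustratedLawDichotomy · two-shell rigidity — `GaugeFix` PROVED for the least-squares gauge (PART A: the configuration-free core)

Lens-5 g32's gauge-fixed directional ladder (`…TwoShellRigidityGaugedLadder{,B,C,D}`, landed p825369–p825523, --supports
stmt-AtomisticToContinuum-27623) moves the isometry ONCE, at the entry: `RegaugeAt`, proved there from the configuration-free
hypothesis `GaugeFix Pat Γ κ` (`regaugeAt_of_gaugeFix`, explicit crude constants) — typed «ANALYTIC · ATTACKABLE·M · Mathlib-only».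
This file proves it for `Γ = lsGauge` and EVERY twelve-point TIGHT FRAME (`Σ_u ⟪u, z⟫ u = 4 z`), with `κ = 2√3`:
`gaugeFix_lsGauge_of_frame`.  PART B (`…GaugeFixPatterns`) shows both kissing patterns are tight frames and draws the consequences
BY NAME (`gaugeFix_fcc/hcp`, unconditional `regaugeAt_lsGauge_fcc/hcp`, the crux of 27623 with the re-gauging hypotheses discharged).

## Proof (variational, configuration-free)

Minimise `g(c) = Σ_u ‖p_u − Σ_k u_k c_k‖²` over orthonormal frames `c = (c₀, c₁, c₂)` of `ℝ³` (a compact set; `g` continuous, §5).  At a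
minimiser, comparing with the frame rotated in the `(c₀, c₁)`-plane by an angle `t` gives `sin t · S ≤ (1 − cos t) · B` for all real `t`
(§3), whence `S = 0` (§1) — and `S` is exactly the third component of `Σ_u u × (A'⁻¹ p_u − u)` for the isometry `A'` with frame `c`; the other
two components follow by cyclic reindexing of the coordinates (§4): that is `lsGauge`.  Closeness (§6): `g(c) ≤ g(frame of A) ≤ 12 a²`, so
`Σ_u ‖(A' − A) u‖² ≤ 48 a²`; the tight-frame identity `4 z = Σ_u ⟪u, z⟫ u` and Cauchy–Schwarz give `‖(A' − A) z‖ ≤ ¼ · 2‖z‖ · √48 · a = 2√3 · a · ‖z‖`.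
(The sharp constant `√6` would use that `A⁻¹A'` is a rotation; not needed downstream — any `κ` makes `RegaugeAt` unconditional.)
[folklore: first-order condition of the orthogonal Procrustes / Kabsch fit]

DEF-FREE; Mathlib-only analysis; 0 sorry.  Prover hand 1, gen 12 (decomp-a2c), --supports stmt-AtomisticToContinuum-27623.
-/

noncomputable section

namespace Summit.AtomisticToContinuum.Crystallization.Theorems.FrustratedLawDichotomyTwoShellRigidityGaugeFix

open Literature.Geometry.DiscreteGeometry
open Summit.AtomisticToContinuum.Crystallization.Theorems.FrustratedLawDichotomyTwoShellRigidityCut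
open Summit.AtomisticToContinuum.Crystallization.Theorems.FrustratedLawDichotomyTwoShellRigidityGaugedLadder
open scoped RealInnerProductSpace

/-! ## 1. One real-variable lemma: `sin t · S ≤ (1 − cos t) · B` for all `t` forces `S = 0` -/

/-- If `sin t · S ≤ (1 − cos t) · B` for every real `t`, then `S = 0` (first order in `t` beats second order). [folklore] -/
theorem eq_zero_of_sin_mul_le {S B : ℝ} (h : ∀ t : ℝ, Real.sin t * S ≤ (1 - Real.cos t) * B) : S = 0 := by
  by_contra hS
  have key : ∀ ε : ℝ, 0 < ε → ε ≤ 1 → 3 / 4 * ε * |S| ≤ ε ^ 2 / 2 * |B| := by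
    intro ε hε0 hε1
    have hsin : ε - ε ^ 3 / 6 < Real.sin ε := Real.sin_gt_sub_cube hε0
    have hε3 : ε ^ 3 ≤ ε := by
      have h2 : ε ^ 2 ≤ 1 := by nlinarith
      nlinarith
    have hsin' : 3 / 4 * ε ≤ Real.sin ε := by linarith
    have hcos' : 1 - Real.cos ε ≤ ε ^ 2 / 2 := by linarith [Real.one_sub_sq_div_two_le_cos (x := ε)]
    have h1c : 0 ≤ 1 - Real.cos ε := by linarith [Real.cos_le_one ε]
    rcases lt_or_gt_of_ne hS with hneg | hpos
    · have hh := h (-ε)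
      rw [Real.sin_neg, Real.cos_neg] at hh
      rw [abs_of_neg hneg]
      calc 3 / 4 * ε * -S ≤ Real.sin ε * -S := by nlinarith
        _ = -Real.sin ε * S := by ring
        _ ≤ (1 - Real.cos ε) * B := hh
        _ ≤ (1 - Real.cos ε) * |B| := mul_le_mul_of_nonneg_left (le_abs_self B) h1c
        _ ≤ ε ^ 2 / 2 * |B| := mul_le_mul_of_nonneg_right hcos' (abs_nonneg B)
    · have hh := h ε
      rw [abs_of_pos hpos]
      calc 3 / 4 * ε * S ≤ Real.sin ε * S := by nlinarith
        _ ≤ (1 - Real.cos ε) * B := hh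
        _ ≤ (1 - Real.cos ε) * |B| := mul_le_mul_of_nonneg_left (le_abs_self B) h1c
        _ ≤ ε ^ 2 / 2 * |B| := mul_le_mul_of_nonneg_right hcos' (abs_nonneg B)
  have hSpos : 0 < |S| := abs_pos.2 hS
  have hB1 : 0 < |B| + 1 := by positivity
  set ε : ℝ := min 1 (|S| / (|B| + 1)) with hε
  have hε0 : 0 < ε := lt_min one_pos (div_pos hSpos hB1)
  have hε1 : ε ≤ 1 := min_le_left _ _
  have hε2 : ε ≤ |S| / (|B| + 1) := min_le_right _ _
  have hk := key ε hε0 hε1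
  have h3 : 3 / 4 * |S| ≤ ε / 2 * |B| := by nlinarith
  have h4 : ε * |B| ≤ |S| / (|B| + 1) * |B| := mul_le_mul_of_nonneg_right hε2 (abs_nonneg B)
  have h5 : |S| / (|B| + 1) * |B| < |S| := by
    have hlt : |B| / (|B| + 1) < 1 := by rw [div_lt_one hB1]; linarith
    calc |S| / (|B| + 1) * |B| = |S| * (|B| / (|B| + 1)) := by ring
      _ < |S| * 1 := mul_lt_mul_of_pos_left hlt hSpos
      _ = |S| := mul_one _
  linarith

/-! ## 2. Coordinates on `E3` -/

/-- The squared norm of a point of `ℝ³` in coordinates. [folklore] -/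
private theorem norm_sq_coord (x : E3) : ‖x‖ ^ 2 = x 0 ^ 2 + x 1 ^ 2 + x 2 ^ 2 := by
  rw [EuclideanSpace.real_norm_sq_eq, Fin.sum_univ_three]

/-- First coordinate of `vec3`. -/
@[simp] private theorem vec3_apply_zero (a b c : ℝ) : vec3 a b c 0 = a := rfl
/-- Second coordinate of `vec3`. -/
@[simp] private theorem vec3_apply_one (a b c : ℝ) : vec3 a b c 1 = b := rfl
/-- Third coordinate of `vec3`. -/
@[simp] private theorem vec3_apply_two (a b c : ℝ) : vec3 a b c 2 = c := rfl

/-- `‖q − v‖²` in coordinates. [folklore] -/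
private theorem norm_sub_sq_coord (q v : E3) :
    ‖q - v‖ ^ 2 = (q 0 - v 0) ^ 2 + (q 1 - v 1) ^ 2 + (q 2 - v 2) ^ 2 := by
  rw [norm_sq_coord]; rfl


/-! ## 3. The first-order condition at a minimising frame (rotation in the `(c₀, c₁)`-plane) -/

/-- An orthonormal triple in `ℝ³` is an orthonormal basis; the orthonormal basis with `⇑b = c`. [folklore] -/
private theorem exists_onb {c : Fin 3 → E3} (hc : Orthonormal ℝ c) : ∃ b : OrthonormalBasis (Fin 3) ℝ E3, ⇑b = c := by
  have hcard : Module.finrank ℝ E3 = Fintype.card (Fin 3) := finrank_euclideanSpace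
  have hsp : ⊤ ≤ Submodule.span ℝ (Set.range c) :=
    (hc.linearIndependent.span_eq_top_of_card_eq_finrank' hcard.symm).ge
  exact ⟨OrthonormalBasis.mk hc hsp, OrthonormalBasis.coe_mk hc hsp⟩

/-- In the frame `c = ⇑b`: `‖p − Σ_k w_k c_k‖² = Σ_k (⟪c_k, p⟫ − w_k)²`. [folklore] -/
private theorem norm_sub_frame_sq (b : OrthonormalBasis (Fin 3) ℝ E3) (p w : E3) :
    ‖p - ∑ k, w k • b k‖ ^ 2 = (⟪b 0, p⟫ - w 0) ^ 2 + (⟪b 1, p⟫ - w 1) ^ 2 + (⟪b 2, p⟫ - w 2) ^ 2 := by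
  rw [b.sum_repr_symm w, ← b.repr.norm_map (p - b.repr.symm w), map_sub, LinearIsometryEquiv.apply_symm_apply,
    norm_sub_sq_coord, b.repr_apply_apply, b.repr_apply_apply, b.repr_apply_apply]

/-- Three pairwise orthogonal unit vectors form an orthonormal triple. [folklore] -/
private theorem orthonormal_triple {v0 v1 v2 : E3} (n0 : ‖v0‖ = 1) (n1 : ‖v1‖ = 1) (n2 : ‖v2‖ = 1)
    (e01 : ⟪v0, v1⟫ = 0) (e02 : ⟪v0, v2⟫ = 0) (e12 : ⟪v1, v2⟫ = 0) : Orthonormal ℝ ![v0, v1, v2] := by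
  classical
  have e10 : ⟪v1, v0⟫ = 0 := by rw [real_inner_comm]; exact e01
  have e20 : ⟪v2, v0⟫ = 0 := by rw [real_inner_comm]; exact e02
  have e21 : ⟪v2, v1⟫ = 0 := by rw [real_inner_comm]; exact e12
  rw [orthonormal_iff_ite]
  intro i j
  fin_cases i <;> fin_cases j <;> simp [e01, e02, e12, e10, e20, e21, n0, n1, n2]

/-- `⟪v, v⟫ = 1` means `‖v‖ = 1`. [folklore] -/
private theorem norm_eq_one_of_inner_self {v : E3} (h : ⟪v, v⟫ = 1) : ‖v‖ = 1 := by
  rw [real_inner_self_eq_norm_sq] at h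
  nlinarith [norm_nonneg v]

/-- The frame rotated by `t` in the `(c₀, c₁)`-plane is orthonormal. [folklore] -/
private theorem orthonormal_rot {c : Fin 3 → E3} (hc : Orthonormal ℝ c) (t : ℝ) :
    Orthonormal ℝ ![Real.cos t • c 0 + Real.sin t • c 1, -(Real.sin t • c 0) + Real.cos t • c 1, c 2] := by
  classical
  have h := orthonormal_iff_ite.1 hc
  have h00 : ⟪c 0, c 0⟫ = 1 := by simpa using h 0 0
  have h11 : ⟪c 1, c 1⟫ = 1 := by simpa using h 1 1
  have h01 : ⟪c 0, c 1⟫ = 0 := by simpa using h 0 1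
  have h02 : ⟪c 0, c 2⟫ = 0 := by simpa using h 0 2
  have h12 : ⟪c 1, c 2⟫ = 0 := by simpa using h 1 2
  have h10 : ⟪c 1, c 0⟫ = 0 := by rw [real_inner_comm]; exact h01
  have hsc := Real.sin_sq_add_cos_sq t
  have e00 : ⟪Real.cos t • c 0 + Real.sin t • c 1, Real.cos t • c 0 + Real.sin t • c 1⟫ = 1 := by
    simp only [inner_add_left, inner_add_right, real_inner_smul_left, real_inner_smul_right, h00, h01, h10, h11]
    linear_combination hsc
  have e01 : ⟪Real.cos t • c 0 + Real.sin t • c 1, -(Real.sin t • c 0) + Real.cos t • c 1⟫ = 0 := by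
    simp only [inner_add_left, inner_add_right, inner_neg_right, real_inner_smul_left, real_inner_smul_right,
      h00, h01, h10, h11]
    ring
  have e02 : ⟪Real.cos t • c 0 + Real.sin t • c 1, c 2⟫ = 0 := by
    simp only [inner_add_left, real_inner_smul_left, h02, h12]
    ring
  have e11 : ⟪-(Real.sin t • c 0) + Real.cos t • c 1, -(Real.sin t • c 0) + Real.cos t • c 1⟫ = 1 := by
    simp only [inner_add_left, inner_add_right, inner_neg_left, inner_neg_right, real_inner_smul_left,
      real_inner_smul_right, h00, h01, h10, h11]
    linear_combination hsc
  have e12 : ⟪-(Real.sin t • c 0) + Real.cos t • c 1, c 2⟫ = 0 := by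
    simp only [inner_add_left, inner_neg_left, real_inner_smul_left, h02, h12]
    ring
  exact orthonormal_triple (norm_eq_one_of_inner_self e00) (norm_eq_one_of_inner_self e11) (hc.1 2) e01 e02 e12

/-- Expanding a vector in the rotated frame = expanding the rotated coordinates in the old frame. [folklore] -/
private theorem sum_smul_rot (c : Fin 3 → E3) (t : ℝ) (v : E3) :
    ∑ k, v k • (![Real.cos t • c 0 + Real.sin t • c 1, -(Real.sin t • c 0) + Real.cos t • c 1, c 2] : Fin 3 → E3) k =
      ∑ k, (vec3 (Real.cos t * v 0 - Real.sin t * v 1) (Real.sin t * v 0 + Real.cos t * v 1) (v 2)) k • c k := by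
  simp only [Fin.sum_univ_three, Matrix.cons_val_zero, Matrix.cons_val_one, Matrix.cons_val_two, Matrix.head_cons,
    Matrix.tail_cons, vec3_apply_zero, vec3_apply_one, vec3_apply_two]
  module

/-- **First-order condition.** If the orthonormal frame `c` minimises `Σ_i ‖p_i − Σ_k (u_i)_k c_k‖²` among orthonormal frames, then
`Σ_i ((u_i)₀ ⟪c₁, p_i⟫ − (u_i)₁ ⟪c₀, p_i⟫) = 0` (variation = rotation in the `(c₀, c₁)`-plane).
[folklore: orthogonal Procrustes / Kabsch first-order condition] -/
theorem firstOrder_rot {ι : Type*} [Fintype ι] (u p : ι → E3) {c : Fin 3 → E3} (hc : Orthonormal ℝ c)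
    (hmin : ∀ d : Fin 3 → E3, Orthonormal ℝ d →
      ∑ i, ‖p i - ∑ k, (u i) k • c k‖ ^ 2 ≤ ∑ i, ‖p i - ∑ k, (u i) k • d k‖ ^ 2) :
    ∑ i, ((u i) 0 * ⟪c 1, p i⟫ - (u i) 1 * ⟪c 0, p i⟫) = 0 := by
  obtain ⟨b, hb⟩ := exists_onb hc
  subst hb
  set S : ℝ := ∑ i, ((u i) 0 * ⟪b 1, p i⟫ - (u i) 1 * ⟪b 0, p i⟫) with hS
  set B : ℝ := ∑ i, ((u i) 0 * ⟪b 0, p i⟫ + (u i) 1 * ⟪b 1, p i⟫) with hB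
  refine eq_zero_of_sin_mul_le (B := B) fun t => ?_
  have hle := hmin _ (orthonormal_rot b.orthonormal t)
  simp_rw [sum_smul_rot (⇑b) t, norm_sub_frame_sq, vec3_apply_zero, vec3_apply_one, vec3_apply_two] at hle
  have hsc := Real.sin_sq_add_cos_sq t
  have hdiff : ∀ i, ((⟪b 0, p i⟫ - (Real.cos t * (u i) 0 - Real.sin t * (u i) 1)) ^ 2
      + (⟪b 1, p i⟫ - (Real.sin t * (u i) 0 + Real.cos t * (u i) 1)) ^ 2 + (⟪b 2, p i⟫ - (u i) 2) ^ 2)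
      - ((⟪b 0, p i⟫ - (u i) 0) ^ 2 + (⟪b 1, p i⟫ - (u i) 1) ^ 2 + (⟪b 2, p i⟫ - (u i) 2) ^ 2)
      = -2 * Real.sin t * ((u i) 0 * ⟪b 1, p i⟫ - (u i) 1 * ⟪b 0, p i⟫)
        + 2 * (1 - Real.cos t) * ((u i) 0 * ⟪b 0, p i⟫ + (u i) 1 * ⟪b 1, p i⟫) := by
    intro i
    linear_combination ((u i) 0 ^ 2 + (u i) 1 ^ 2) * hsc
  have h0 : 0 ≤ ∑ i, (-2 * Real.sin t * ((u i) 0 * ⟪b 1, p i⟫ - (u i) 1 * ⟪b 0, p i⟫)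
      + 2 * (1 - Real.cos t) * ((u i) 0 * ⟪b 0, p i⟫ + (u i) 1 * ⟪b 1, p i⟫)) := by
    rw [← Finset.sum_congr rfl fun i _ => hdiff i, Finset.sum_sub_distrib]
    linarith
  rw [Finset.sum_add_distrib, ← Finset.mul_sum, ← Finset.mul_sum] at h0
  linarith


/-! ## 4. The other two components by cyclic reindexing of the coordinates -/

/-- Cyclic reindexing `(0 1 2) ↦ (1 2 0)` of coordinates and frame keeps the functional and the minimality. [folklore] -/
private theorem min_rotate {ι : Type*} [Fintype ι] (u p : ι → E3) {c : Fin 3 → E3} (hc : Orthonormal ℝ c)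
    (hmin : ∀ d : Fin 3 → E3, Orthonormal ℝ d →
      ∑ i, ‖p i - ∑ k, (u i) k • c k‖ ^ 2 ≤ ∑ i, ‖p i - ∑ k, (u i) k • d k‖ ^ 2) :
    Orthonormal ℝ ![c 1, c 2, c 0] ∧ ∀ d : Fin 3 → E3, Orthonormal ℝ d →
      ∑ i, ‖p i - ∑ k, (vec3 ((u i) 1) ((u i) 2) ((u i) 0)) k • (![c 1, c 2, c 0] : Fin 3 → E3) k‖ ^ 2 ≤
        ∑ i, ‖p i - ∑ k, (vec3 ((u i) 1) ((u i) 2) ((u i) 0)) k • d k‖ ^ 2 := by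
  classical
  have hrot : ∀ d : Fin 3 → E3, Orthonormal ℝ d → Orthonormal ℝ ![d 1, d 2, d 0] := by
    intro d hd
    have h := orthonormal_iff_ite.1 hd
    rw [orthonormal_iff_ite]
    intro i j
    fin_cases i <;> fin_cases j <;> simp [h, hd.1]
  refine ⟨hrot c hc, fun d hd => ?_⟩
  have h1 : ∀ i, ∑ k, (vec3 ((u i) 1) ((u i) 2) ((u i) 0)) k • (![c 1, c 2, c 0] : Fin 3 → E3) k =
      ∑ k, (u i) k • c k := by
    intro i
    simp only [Fin.sum_univ_three, Matrix.cons_val_zero, Matrix.cons_val_one, Matrix.cons_val_two, Matrix.head_cons,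
      Matrix.tail_cons, vec3_apply_zero, vec3_apply_one, vec3_apply_two]
    abel
  have h2 : ∀ i, ∑ k, (vec3 ((u i) 1) ((u i) 2) ((u i) 0)) k • d k =
      ∑ k, (u i) k • (![d 2, d 0, d 1] : Fin 3 → E3) k := by
    intro i
    simp only [Fin.sum_univ_three, Matrix.cons_val_zero, Matrix.cons_val_one, Matrix.cons_val_two, Matrix.head_cons,
      Matrix.tail_cons, vec3_apply_zero, vec3_apply_one, vec3_apply_two]
    abel
  simp_rw [h1, h2]
  refine hmin _ ?_
  have := hrot _ (hrot d hd)
  simpa using this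

/-- **All three first-order conditions** at a minimising frame — the three components of `Σ_i u_i × (⟪c_·, p_i⟫)`. [folklore] -/
theorem firstOrder_all {ι : Type*} [Fintype ι] (u p : ι → E3) {c : Fin 3 → E3} (hc : Orthonormal ℝ c)
    (hmin : ∀ d : Fin 3 → E3, Orthonormal ℝ d →
      ∑ i, ‖p i - ∑ k, (u i) k • c k‖ ^ 2 ≤ ∑ i, ‖p i - ∑ k, (u i) k • d k‖ ^ 2) :
    ∑ i, ((u i) 1 * ⟪c 2, p i⟫ - (u i) 2 * ⟪c 1, p i⟫) = 0 ∧
      ∑ i, ((u i) 2 * ⟪c 0, p i⟫ - (u i) 0 * ⟪c 2, p i⟫) = 0 ∧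
        ∑ i, ((u i) 0 * ⟪c 1, p i⟫ - (u i) 1 * ⟪c 0, p i⟫) = 0 := by
  obtain ⟨hc', hmin'⟩ := min_rotate u p hc hmin
  obtain ⟨hc'', hmin''⟩ := min_rotate _ p hc' hmin'
  refine ⟨?_, ?_, firstOrder_rot u p hc hmin⟩
  · have := firstOrder_rot _ p hc' hmin'
    simpa using this
  · have := firstOrder_rot _ p hc'' hmin''
    simpa using this

/-! ## 5. Existence of a minimising frame (compactness of the orthonormal frames) -/

/-- A minimising orthonormal frame exists: the orthonormal frames of `ℝ³` form a compact set and the functional is continuous. [folklore] -/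
theorem exists_min_frame {ι : Type*} [Fintype ι] (u p : ι → E3) :
    ∃ c : Fin 3 → E3, Orthonormal ℝ c ∧ ∀ d : Fin 3 → E3, Orthonormal ℝ d →
      ∑ i, ‖p i - ∑ k, (u i) k • c k‖ ^ 2 ≤ ∑ i, ‖p i - ∑ k, (u i) k • d k‖ ^ 2 := by
  classical
  set K : Set (Fin 3 → E3) := {c | Orthonormal ℝ c} with hK
  have hKeq : K = ⋂ i : Fin 3, ⋂ j : Fin 3, {c : Fin 3 → E3 | ⟪c i, c j⟫ = if i = j then (1 : ℝ) else 0} := by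
    ext c
    simp only [hK, Set.mem_setOf_eq, Set.mem_iInter, orthonormal_iff_ite]
  have hKc : IsClosed K := by
    rw [hKeq]
    exact isClosed_iInter fun i => isClosed_iInter fun j =>
      isClosed_eq ((continuous_apply i).inner (continuous_apply j)) continuous_const
  have hKb : Bornology.IsBounded K := by
    refine (Metric.isBounded_closedBall (x := (0 : Fin 3 → E3)) (r := 1)).subset fun c hc => ?_
    rw [Metric.mem_closedBall, dist_zero_right, pi_norm_le_iff_of_nonneg zero_le_one]
    exact fun i => (hc.1 i).le
  have hKne : K.Nonempty := ⟨⇑(EuclideanSpace.basisFun (Fin 3) ℝ), (EuclideanSpace.basisFun (Fin 3) ℝ).orthonormal⟩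
  have hf : Continuous fun c : Fin 3 → E3 => ∑ i, ‖p i - ∑ k, (u i) k • c k‖ ^ 2 := by fun_prop
  obtain ⟨c, hcK, hcmin⟩ := (Metric.isCompact_of_isClosed_isBounded hKc hKb).exists_isMinOn hKne hf.continuousOn
  exact ⟨c, hcK, fun d hd => (isMinOn_iff.1 hcmin) d hd⟩

/-! ## 6. Closeness from the tight-frame identity, and `GaugeFix` -/

/-- Expanding in the frame of an isometry: `Σ_k v_k • A e_k = A v`. [folklore] -/
private theorem sum_smul_map_basisFun (A : E3 ≃ₗᵢ[ℝ] E3) (v : E3) :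
    ∑ k, v k • A ((EuclideanSpace.basisFun (Fin 3) ℝ) k) = A v := by
  have h := (EuclideanSpace.basisFun (Fin 3) ℝ).sum_repr v
  simp only [EuclideanSpace.basisFun_repr] at h
  calc ∑ k, v k • A ((EuclideanSpace.basisFun (Fin 3) ℝ) k)
      = A (∑ k, v k • (EuclideanSpace.basisFun (Fin 3) ℝ) k) := by
        rw [map_sum]
        exact Finset.sum_congr rfl fun k _ => (map_smul A (v k) _).symm
    _ = A v := by rw [h]

/-- **`GaugeFix` for the least-squares gauge with `κ = 2√3`, for every twelve-point tight frame** (`Σ_u ⟪u, z⟫ u = 4 z`):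
near any isometry `A` with `‖p_u − A u‖ ≤ a` there is an isometry `A'` with `Σ_u u × (A'⁻¹ p_u − u) = 0` and
`‖A' z − A z‖ ≤ 2√3 · a · ‖z‖`. [folklore: orthogonal Procrustes / Kabsch] -/
theorem gaugeFix_lsGauge_of_frame {Pat : Finset E3} (hcard : Pat.card = 12)
    (hframe : ∀ z : E3, ∑ u : ↥Pat, ⟪(u : E3), z⟫ • (u : E3) = (4 : ℝ) • z) :
    GaugeFix Pat (lsGauge Pat) (2 * Real.sqrt 3) := by
  intro p A a hp
  obtain ⟨c, hc, hmin⟩ := exists_min_frame (fun u : ↥Pat => (u : E3)) p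
  obtain ⟨b, hb⟩ := exists_onb hc
  subst hb
  refine ⟨b.repr.symm, ?_, ?_⟩
  · -- the gauge: the three first-order conditions
    obtain ⟨e1, e2, e3⟩ := firstOrder_all (fun u : ↥Pat => (u : E3)) p b.orthonormal hmin
    have hx : ∀ (u : ↥Pat) (k : Fin 3), (b.repr.symm.symm (p u) - (u : E3)) k = ⟪b k, p u⟫ - (u : E3) k := by
      intro u k
      rw [LinearIsometryEquiv.symm_symm, PiLp.sub_apply, b.repr_apply_apply]
    simp only [lsGauge, hx]
    refine ⟨?_, ?_, ?_⟩
    · rw [← e1]; exact Finset.sum_congr rfl fun u _ => by ring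
    · rw [← e2]; exact Finset.sum_congr rfl fun u _ => by ring
    · rw [← e3]; exact Finset.sum_congr rfl fun u _ => by ring
  · -- closeness
    intro z
    have hPat_ne : Pat.Nonempty := by rw [← Finset.card_pos, hcard]; norm_num
    obtain ⟨u₀, hu₀⟩ := hPat_ne
    have ha : 0 ≤ a := (norm_nonneg _).trans (hp ⟨u₀, hu₀⟩)
    have h12 : ∀ f : ↥Pat → ℝ, (∀ u, f u ≤ a ^ 2) → ∑ u, f u ≤ 12 * a ^ 2 := by
      intro f hf
      calc ∑ u, f u ≤ ∑ _u : ↥Pat, a ^ 2 := Finset.sum_le_sum fun u _ => hf u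
        _ = 12 * a ^ 2 := by rw [Finset.sum_const, Finset.card_univ, Fintype.card_coe, hcard, nsmul_eq_mul]; norm_num
    -- the functional at the frame of `A` is `Σ ‖p u − A u‖² ≤ 12 a²`, hence so is its value at the minimiser
    set cA : Fin 3 → E3 := fun k => A ((EuclideanSpace.basisFun (Fin 3) ℝ) k) with hcA
    have hcA_on : Orthonormal ℝ cA := (EuclideanSpace.basisFun (Fin 3) ℝ).orthonormal.comp_linearIsometryEquiv A
    have hpA : ∑ u : ↥Pat, ‖p u - A u‖ ^ 2 ≤ 12 * a ^ 2 :=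
      h12 _ fun u => pow_le_pow_left₀ (norm_nonneg _) (hp u) 2
    have hgc : ∑ u : ↥Pat, ‖p u - b.repr.symm (u : E3)‖ ^ 2 ≤ 12 * a ^ 2 := by
      have h := hmin cA hcA_on
      simp_rw [hcA, sum_smul_map_basisFun, b.sum_repr_symm] at h
      exact h.trans hpA
    -- `Σ ‖A' u − A u‖² ≤ 48 a²`
    have hM : ∑ u : ↥Pat, ‖b.repr.symm (u : E3) - A u‖ ^ 2 ≤ 48 * a ^ 2 := by
      have hterm : ∀ u : ↥Pat, ‖b.repr.symm (u : E3) - A u‖ ^ 2 ≤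
          2 * ‖p u - b.repr.symm (u : E3)‖ ^ 2 + 2 * ‖p u - A u‖ ^ 2 := by
        intro u
        have htri : ‖b.repr.symm (u : E3) - A u‖ ≤ ‖p u - A u‖ + ‖p u - b.repr.symm (u : E3)‖ := by
          calc ‖b.repr.symm (u : E3) - A u‖ = ‖(p u - A u) - (p u - b.repr.symm (u : E3))‖ := by congr 1; abel
            _ ≤ ‖p u - A u‖ + ‖p u - b.repr.symm (u : E3)‖ := norm_sub_le _ _
        have hsq2 := pow_le_pow_left₀ (norm_nonneg _) htri 2
        nlinarith [hsq2, sq_nonneg (‖p u - A u‖ - ‖p u - b.repr.symm (u : E3)‖)]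
      calc ∑ u : ↥Pat, ‖b.repr.symm (u : E3) - A u‖ ^ 2
          ≤ ∑ u : ↥Pat, (2 * ‖p u - b.repr.symm (u : E3)‖ ^ 2 + 2 * ‖p u - A u‖ ^ 2) :=
            Finset.sum_le_sum fun u _ => hterm u
        _ = 2 * ∑ u : ↥Pat, ‖p u - b.repr.symm (u : E3)‖ ^ 2 + 2 * ∑ u : ↥Pat, ‖p u - A u‖ ^ 2 := by
            rw [Finset.sum_add_distrib, Finset.mul_sum, Finset.mul_sum]
        _ ≤ 48 * a ^ 2 := by linarith
    -- the tight-frame identity transports `z`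
    have h4 : (4 : ℝ) • (b.repr.symm z - A z) = ∑ u : ↥Pat, ⟪(u : E3), z⟫ • (b.repr.symm (u : E3) - A u) := by
      calc (4 : ℝ) • (b.repr.symm z - A z) = b.repr.symm ((4 : ℝ) • z) - A ((4 : ℝ) • z) := by
            rw [map_smul, map_smul, smul_sub]
        _ = b.repr.symm (∑ u : ↥Pat, ⟪(u : E3), z⟫ • (u : E3)) - A (∑ u : ↥Pat, ⟪(u : E3), z⟫ • (u : E3)) := by
            rw [hframe z]
        _ = ∑ u : ↥Pat, ⟪(u : E3), z⟫ • (b.repr.symm (u : E3) - A u) := by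
            rw [map_sum, map_sum, ← Finset.sum_sub_distrib]
            refine Finset.sum_congr rfl fun u _ => ?_
            rw [map_smul, map_smul, smul_sub]
    have hsq : ∑ u : ↥Pat, ⟪(u : E3), z⟫ ^ 2 = 4 * ‖z‖ ^ 2 := by
      have h := congrArg (fun w : E3 => ⟪w, z⟫) (hframe z)
      simp only [sum_inner, real_inner_smul_left, real_inner_self_eq_norm_sq] at h
      simpa [sq] using h
    have hCS : ‖∑ u : ↥Pat, ⟪(u : E3), z⟫ • (b.repr.symm (u : E3) - A u)‖ ≤
        Real.sqrt (∑ u : ↥Pat, ⟪(u : E3), z⟫ ^ 2) * Real.sqrt (∑ u : ↥Pat, ‖b.repr.symm (u : E3) - A u‖ ^ 2) := by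
      calc ‖∑ u : ↥Pat, ⟪(u : E3), z⟫ • (b.repr.symm (u : E3) - A u)‖
          ≤ ∑ u : ↥Pat, ‖⟪(u : E3), z⟫ • (b.repr.symm (u : E3) - A u)‖ := norm_sum_le _ _
        _ = ∑ u : ↥Pat, |⟪(u : E3), z⟫| * ‖b.repr.symm (u : E3) - A u‖ := by
            simp_rw [norm_smul, Real.norm_eq_abs]
        _ ≤ Real.sqrt (∑ u : ↥Pat, |⟪(u : E3), z⟫| ^ 2) * Real.sqrt (∑ u : ↥Pat, ‖b.repr.symm (u : E3) - A u‖ ^ 2) :=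
            Real.sum_mul_le_sqrt_mul_sqrt _ _ _
        _ = _ := by simp_rw [sq_abs]
    have hs1 : Real.sqrt (∑ u : ↥Pat, ⟪(u : E3), z⟫ ^ 2) = 2 * ‖z‖ := by
      rw [hsq, show (4 : ℝ) * ‖z‖ ^ 2 = (2 * ‖z‖) ^ 2 by ring, Real.sqrt_sq (by positivity)]
    have hs2 : Real.sqrt (∑ u : ↥Pat, ‖b.repr.symm (u : E3) - A u‖ ^ 2) ≤ 4 * Real.sqrt 3 * a := by
      calc Real.sqrt (∑ u : ↥Pat, ‖b.repr.symm (u : E3) - A u‖ ^ 2) ≤ Real.sqrt (48 * a ^ 2) := Real.sqrt_le_sqrt hM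
        _ = 4 * Real.sqrt 3 * a := by
            rw [show (48 : ℝ) * a ^ 2 = (4 * a) ^ 2 * 3 by ring, Real.sqrt_mul (by positivity), Real.sqrt_sq (by positivity)]
            ring
    have hnorm4 : ‖(4 : ℝ) • (b.repr.symm z - A z)‖ = 4 * ‖b.repr.symm z - A z‖ := by
      rw [norm_smul, Real.norm_eq_abs, abs_of_pos (by norm_num : (0 : ℝ) < 4)]
    have hfin : 4 * ‖b.repr.symm z - A z‖ ≤ 2 * ‖z‖ * (4 * Real.sqrt 3 * a) := by
      rw [← hnorm4, h4]
      refine hCS.trans ?_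
      rw [hs1]
      exact mul_le_mul_of_nonneg_left hs2 (by positivity)
    nlinarith [hfin, norm_nonneg z, Real.sqrt_nonneg 3]

end Summit.AtomisticToContinuum.Crystallization.Theorems.FrustratedLawDichotomyTwoShellRigidityGaugeFix
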